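import Summits.CriticalPhenomena.PercolationContinuityZ3.Theorems.Transplant.NboSignQuasiChart
import HarnessLib

/-!
# The `nbo` net in geometric coordinates, II: (κ) — every cylinder `{w ∈ sites | ‖chart w − chart t‖_∞ ≤ ℓ}`, `ℓ ≥ 1`, is CONNECTED
# (descent by the 2-path quasi-steps of `NboSignQuasiChart`, then the fibre over the base value chained along the `x`-axis)

builds on p205010 (kernel theorem, internal audit signed; external expert review pending) — nothing in this file uses p205010; NOTHING is claimed about
`θ_{nbo}(p_c)` nor about any node.  Lane `prim-bschramm`, seat `prim-bschramm-p4` (gen 20; PART C3, `HOME/bschramm/P4-GENERAL.md` §42.4).  Helper file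
(`--supports stmt-CriticalPhenomena-4575 --as helper`); sequel of `NboSignQuasiChart` (Sign-complete symmetry, frames, quasi-steps).  With this file nbo
satisfies, on its site set, EVERY field of `PlanarSkeletonSign` except single-edge (ι) — which is replaced by `NboZ3.qstep` (unit steps along paths of
length `≤ 2` with a chart-neutral first edge) — as kernel facts: `NboZ3.lip`, `reflIso`/`exists_neg`/`exists_flipSnd`/`exists_flipFst`, `shiftIso`/
`exists_frame`, `qstep`, and **`NboZ3.cyl_connected`** below.
* `cylSites t ℓ`; `exists_reachable_fibre` (descent by quasi-steps inside the cylinder); `fibre_reachable` (the fibre `t + ℤ e_x` ∩ sites is chained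
  inside the unit cylinder: direct `x`-bonds, and the detour `· → ·+e_y → ·+e_y∓e_x → ·+e_y∓2e_x → ·∓2e_x` across a non-site); **`cyl_connected`**.
[cite: KozmaNitzan2024, §4 p. 15 (connected cylinders)] [cite: ConwaySloane1999, Ch. 4 §7.1]
-/

noncomputable section

namespace Summit.CriticalPhenomena.PercolationContinuityZ3.Theorems.Transplant

open SimpleGraph Literature.Probability.LatticeModels Literature.Probability.Percolation
open scoped Classical

namespace NboZ3

/-! ## §5 (κ) on sites: the cylinders `{w ∈ sites | chart w − chart t ∈ Λ_ℓ}`, `ℓ ≥ 1`, are connected -/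

/-- The cylinder of half-width `ℓ` at `t`, restricted to sites. [cite: KozmaNitzan2024, §4 p. 15 (boxes)] -/
def cylSites (t : Site 3) (ℓ : ℕ) : Set (Site 3) := {w | w ∈ sites ∧ chart w - chart t ∈ box 2 ℓ}

/-- An edge `a ∼ a + u` between sites, `u` a signed unit vector. [folklore] -/
theorem adj_add {a u : Site 3} (ha : a ∈ sites) (hb : a + u ∈ sites) (hu : u ∈ units3) : graph.Adj a (a + u) :=
  adj_of _ _ ha hb (by rwa [add_sub_cancel_left])

/-- Neighbours are sites. [folklore] -/
theorem mem_sites_of_adj {x y : Site 3} (h : graph.Adj x y) : y ∈ sites := ((adj_iff x y).1 h).2.1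

/-- **Descent by quasi-steps**: inside a cylinder every site is joined, INSIDE the cylinder, to a site over the base chart value. [folklore] -/
theorem exists_reachable_fibre (t : Site 3) (ℓ : ℕ) (w : Site 3) (hw : w ∈ cylSites t ℓ) :
    ∃ (w₀ : Site 3) (h₀ : w₀ ∈ cylSites t ℓ), chart w₀ = chart t ∧ (graph.induce (cylSites t ℓ)).Reachable ⟨w, hw⟩ ⟨w₀, h₀⟩ := by
  suffices H : ∀ n : ℕ, ∀ (w : Site 3) (hw : w ∈ cylSites t ℓ), ((chart w - chart t) 0).natAbs + ((chart w - chart t) 1).natAbs = n →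
      ∃ (w₀ : Site 3) (h₀ : w₀ ∈ cylSites t ℓ), chart w₀ = chart t ∧ (graph.induce (cylSites t ℓ)).Reachable ⟨w, hw⟩ ⟨w₀, h₀⟩ from
    H _ w hw rfl
  intro n
  induction n using Nat.strong_induction_on with
  | _ n ih =>
    intro w hw hn
    set d : Site 2 := chart w - chart t with hd_def
    have hbox : ∀ j, -(ℓ : ℤ) ≤ d j ∧ d j ≤ ℓ := mem_box.1 hw.2
    by_cases h0 : d 0 = 0 ∧ d 1 = 0
    · refine ⟨w, hw, ?_, Reachable.refl _⟩
      have hd0 : d = 0 := by funext j; fin_cases j; exacts [h0.1, h0.2]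
      exact sub_eq_zero.1 (hd_def ▸ hd0)
    obtain ⟨i, hi⟩ : ∃ i : Fin 2, d i ≠ 0 := by
      by_contra hc
      exact h0 ⟨not_not.1 fun h => hc ⟨0, h⟩, not_not.1 fun h => hc ⟨1, h⟩⟩
    obtain ⟨s, hs1, hlt, hrange⟩ : ∃ s : ℤ, (s = 1 ∨ s = -1) ∧ (d i + s).natAbs < (d i).natAbs ∧ (-(ℓ : ℤ) ≤ d i + s ∧ d i + s ≤ ℓ) := by
      have hb := hbox i
      rcases lt_or_gt_of_ne hi with hlt | hgt
      · exact ⟨1, Or.inl rfl, by omega, by omega⟩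
      · exact ⟨-1, Or.inr rfl, by omega, by omega⟩
    obtain ⟨σ, hσ⟩ : ∃ σ : ℤˣ, (σ : ℤ) = s := by
      rcases hs1 with rfl | rfl
      exacts [⟨1, rfl⟩, ⟨-1, rfl⟩]
    obtain ⟨y, z, hwy, hyz, hneutral, hz⟩ := qstep w hw.1 i σ
    have hdz : chart z - chart t = d + Pi.single i s := by rw [hz, hσ, hd_def]; abel
    have hz_box : chart z - chart t ∈ box 2 ℓ := by
      rw [mem_box]; intro j; rw [hdz, Pi.add_apply]
      by_cases hj : j = i
      · subst hj; rw [Pi.single_eq_same]; exact hrange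
      · rw [Pi.single_eq_of_ne hj, add_zero]; exact hbox j
    have hy_sites : y ∈ sites := mem_sites_of_adj hwy
    have hz_sites : z ∈ sites := by
      rcases hyz with rfl | hyz
      · exact hy_sites
      · exact mem_sites_of_adj hyz
    have hz_mem : z ∈ cylSites t ℓ := ⟨hz_sites, hz_box⟩
    have hy_mem : y ∈ cylSites t ℓ := by
      rcases hneutral with rfl | hch
      · exact hz_mem
      · exact ⟨hy_sites, by rw [hch]; exact hw.2⟩
    have hlt' : ((chart z - chart t) 0).natAbs + ((chart z - chart t) 1).natAbs < n := by
      rw [← hn, hdz]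
      fin_cases i <;> simp at hlt ⊢ <;> omega
    obtain ⟨w₀, h₀, hφ₀, hreach⟩ := ih _ hlt' z hz_mem rfl
    have r1 : (graph.induce (cylSites t ℓ)).Reachable ⟨w, hw⟩ ⟨y, hy_mem⟩ :=
      (show (graph.induce (cylSites t ℓ)).Adj ⟨w, hw⟩ ⟨y, hy_mem⟩ from hwy).reachable
    have r2 : (graph.induce (cylSites t ℓ)).Reachable ⟨y, hy_mem⟩ ⟨z, hz_mem⟩ := by
      rcases hyz with rfl | hyz
      · exact Reachable.refl _
      · exact (show (graph.induce (cylSites t ℓ)).Adj ⟨y, hy_mem⟩ ⟨z, hz_mem⟩ from hyz).reachable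
    exact ⟨w₀, h₀, hφ₀, r1.trans (r2.trans hreach)⟩

/-- A point of the fibre over `chart t` is `t` shifted along the `x`-axis. [folklore] -/
theorem eq_add_single_of_chart_eq {t w : Site 3} (h : chart w = chart t) : w = t + Pi.single 0 (w 0 - t 0) := by
  have h1 : w 1 = t 1 := by simpa [chart] using congrFun h 0
  have h2 : w 2 = t 2 := by simpa [chart] using congrFun h 1
  funext k; fin_cases k
  · simp
  · simp [h1]
  · simp [h2]

/-- The chart does not see the `x`-axis. [folklore] -/
theorem chart_add_single_zero (t : Site 3) (d : ℤ) : chart (t + Pi.single 0 d) = chart t := by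
  funext j; fin_cases j <;> simp [chart]

/-- The fibre detour stays at chart offset `e₀`. [folklore] -/
theorem chart_add_single_zero_one (t : Site 3) (d : ℤ) : chart (t + Pi.single 0 d + Pi.single 1 1) - chart t = Pi.single 0 1 := by
  funext j; fin_cases j <;> simp [chart]

/-- **The fibre over the base value is chained inside the unit cylinder**: every site `t + d e_x` is joined to `t` inside `cylSites t ℓ`, `ℓ ≥ 1`
(along the `x`-axis, with the detour `· → · + e_y → · + e_y ∓ e_x → · + e_y ∓ 2e_x → · ∓ 2e_x` where the next `x`-neighbour is not a site).
[cite: KozmaNitzan2024, §4 p. 15 (connected cylinders)] -/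
theorem fibre_reachable (t : Site 3) (ht : t ∈ sites) {ℓ : ℕ} (hℓ : 1 ≤ ℓ) (h1 : t ∈ cylSites t ℓ) :
    ∀ (n : ℕ) (w : cylSites t ℓ) (d : ℤ), (w : Site 3) = t + Pi.single (0 : Fin 3) d → d.natAbs = n →
      (graph.induce (cylSites t ℓ)).Reachable ⟨t, h1⟩ w := by
  intro n
  induction n using Nat.strong_induction_on with
  | _ n ih =>
    rintro ⟨wv, hd⟩ d hwd hdn
    simp only at hwd
    subst hwd
    by_cases hd0 : d = 0
    · subst hd0
      have e : t + Pi.single (0 : Fin 3) (0 : ℤ) = t := by simp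
      have ept : (⟨t + Pi.single (0 : Fin 3) (0 : ℤ), hd⟩ : cylSites t ℓ) = ⟨t, h1⟩ := Subtype.ext e
      rw [ept]
    -- the step towards `t`
    obtain ⟨s, hs, hlt⟩ : ∃ s : ℤ, (s = 1 ∨ s = -1) ∧ (d - s).natAbs < d.natAbs := by
      rcases lt_or_gt_of_ne hd0 with h | h
      · exact ⟨-1, Or.inr rfl, by omega⟩
      · exact ⟨1, Or.inl rfl, by omega⟩
    have hsu : (-(Pi.single 0 s : Site 3)) ∈ units3 := by
      rcases hs with rfl | rfl <;> decide
    have hyu : (Pi.single 1 1 : Site 3) ∈ units3 := by decide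
    have hyu' : (-(Pi.single 1 1 : Site 3)) ∈ units3 := by decide
    -- chart facts
    have hbox0 : ∀ d' : ℤ, chart (t + Pi.single 0 d') - chart t ∈ box 2 ℓ := fun d' => by
      rw [chart_add_single_zero, sub_self]; exact zero_mem_box 2 ℓ
    have hbox1 : ∀ d' : ℤ, chart (t + Pi.single 0 d' + Pi.single 1 1) - chart t ∈ box 2 ℓ := fun d' => by
      rw [chart_add_single_zero_one, mem_box]; intro j
      fin_cases j <;> simp
      omega
    have ht' := ht
    simp only [sites, Set.mem_setOf_eq] at ht'
    by_cases hsite : t + Pi.single 0 (d - s) ∈ sites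
    · -- direct `x`-bond
      have hmem : t + Pi.single 0 (d - s) ∈ cylSites t ℓ := ⟨hsite, hbox0 _⟩
      have hadj : graph.Adj (t + Pi.single 0 d) (t + Pi.single 0 (d - s)) :=
        adj_of _ _ hd.1 hsite (by
          rw [show t + Pi.single 0 (d - s) - (t + Pi.single 0 d) = -(Pi.single 0 s : Site 3) by rw [Pi.single_sub]; abel]
          exact hsu)
      have hlt_n : (d - s).natAbs < n := by rw [← hdn]; exact hlt
      have r := ih _ hlt_n ⟨_, hmem⟩ (d - s) rfl rfl
      exact r.trans (show (graph.induce (cylSites t ℓ)).Adj ⟨_, hmem⟩ ⟨_, hd⟩ from hadj.symm).reachable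
    · -- the next `x`-neighbour is not a site: all three of its coordinates have the same parity; detour through `+ e_y`
      have hns : (t 0 + (d - s)) % 2 = t 1 % 2 ∧ t 1 % 2 = t 2 % 2 := by
        simp only [sites, Set.mem_setOf_eq, not_not, Pi.add_apply, Pi.single_eq_same,
          Pi.single_eq_of_ne (show (1 : Fin 3) ≠ 0 by decide), Pi.single_eq_of_ne (show (2 : Fin 3) ≠ 0 by decide), add_zero] at hsite
        exact hsite
      have hd_site : ((t 0 + d) % 2 = t 1 % 2 ∧ t 1 % 2 = t 2 % 2) → False := by
        have h := hd.1
        simp only [sites, Set.mem_setOf_eq, Pi.add_apply, Pi.single_eq_same,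
          Pi.single_eq_of_ne (show (1 : Fin 3) ≠ 0 by decide), Pi.single_eq_of_ne (show (2 : Fin 3) ≠ 0 by decide), add_zero] at h
        exact h
      -- `d - s ≠ 0` (t itself is a site), so the double step does not overshoot
      have hds : d - s ≠ 0 := by
        rintro h0
        rw [h0, add_zero] at hns
        exact ht' hns
      have hlt2 : (d - 2 * s).natAbs < d.natAbs := by rcases hs with rfl | rfl <;> omega
      -- the four detour vertices are sites
      have m1 : t + Pi.single 0 d + Pi.single 1 1 ∈ sites := by
        simp only [sites, Set.mem_setOf_eq, Pi.add_apply, Pi.single_eq_same,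
          Pi.single_eq_of_ne (show (1 : Fin 3) ≠ 0 by decide), Pi.single_eq_of_ne (show (2 : Fin 3) ≠ 0 by decide),
          Pi.single_eq_of_ne (show (0 : Fin 3) ≠ 1 by decide), Pi.single_eq_of_ne (show (2 : Fin 3) ≠ 1 by decide), add_zero]
        rcases hs with rfl | rfl <;> omega
      have m2 : t + Pi.single 0 (d - s) + Pi.single 1 1 ∈ sites := by
        simp only [sites, Set.mem_setOf_eq, Pi.add_apply, Pi.single_eq_same,
          Pi.single_eq_of_ne (show (1 : Fin 3) ≠ 0 by decide), Pi.single_eq_of_ne (show (2 : Fin 3) ≠ 0 by decide),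
          Pi.single_eq_of_ne (show (0 : Fin 3) ≠ 1 by decide), Pi.single_eq_of_ne (show (2 : Fin 3) ≠ 1 by decide), add_zero]
        omega
      have m3 : t + Pi.single 0 (d - 2 * s) + Pi.single 1 1 ∈ sites := by
        simp only [sites, Set.mem_setOf_eq, Pi.add_apply, Pi.single_eq_same,
          Pi.single_eq_of_ne (show (1 : Fin 3) ≠ 0 by decide), Pi.single_eq_of_ne (show (2 : Fin 3) ≠ 0 by decide),
          Pi.single_eq_of_ne (show (0 : Fin 3) ≠ 1 by decide), Pi.single_eq_of_ne (show (2 : Fin 3) ≠ 1 by decide), add_zero]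
        rcases hs with rfl | rfl <;> omega
      have m4 : t + Pi.single 0 (d - 2 * s) ∈ sites := by
        simp only [sites, Set.mem_setOf_eq, Pi.add_apply, Pi.single_eq_same,
          Pi.single_eq_of_ne (show (1 : Fin 3) ≠ 0 by decide), Pi.single_eq_of_ne (show (2 : Fin 3) ≠ 0 by decide), add_zero]
        rcases hs with rfl | rfl <;> omega
      have c1 : t + Pi.single 0 d + Pi.single 1 1 ∈ cylSites t ℓ := ⟨m1, hbox1 _⟩
      have c2 : t + Pi.single 0 (d - s) + Pi.single 1 1 ∈ cylSites t ℓ := ⟨m2, hbox1 _⟩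
      have c3 : t + Pi.single 0 (d - 2 * s) + Pi.single 1 1 ∈ cylSites t ℓ := ⟨m3, hbox1 _⟩
      have c4 : t + Pi.single 0 (d - 2 * s) ∈ cylSites t ℓ := ⟨m4, hbox0 _⟩
      -- the four edges
      have a1 : graph.Adj (t + Pi.single 0 d) (t + Pi.single 0 d + Pi.single 1 1) := adj_add hd.1 m1 hyu
      have a2 : graph.Adj (t + Pi.single 0 d + Pi.single 1 1) (t + Pi.single 0 (d - s) + Pi.single 1 1) :=
        adj_of _ _ m1 m2 (by
          rw [show t + Pi.single 0 (d - s) + Pi.single 1 1 - (t + Pi.single 0 d + Pi.single 1 1) = -(Pi.single 0 s : Site 3) by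
            rw [Pi.single_sub]; abel]
          exact hsu)
      have a3 : graph.Adj (t + Pi.single 0 (d - s) + Pi.single 1 1) (t + Pi.single 0 (d - 2 * s) + Pi.single 1 1) :=
        adj_of _ _ m2 m3 (by
          have hss : (Pi.single 0 (d - 2 * s) : Site 3) = Pi.single 0 (d - s) - Pi.single 0 s := by
            rw [← Pi.single_sub]; congr 1; ring
          rw [show t + Pi.single 0 (d - 2 * s) + Pi.single 1 1 - (t + Pi.single 0 (d - s) + Pi.single 1 1) = -(Pi.single 0 s : Site 3) by
            rw [hss]; abel]
          exact hsu)
      have a4 : graph.Adj (t + Pi.single 0 (d - 2 * s) + Pi.single 1 1) (t + Pi.single 0 (d - 2 * s)) :=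
        adj_of _ _ m3 m4 (by
          rw [show t + Pi.single 0 (d - 2 * s) - (t + Pi.single 0 (d - 2 * s) + Pi.single 1 1) = -(Pi.single 1 1 : Site 3) by abel]
          exact hyu')
      have hlt2_n : (d - 2 * s).natAbs < n := by rw [← hdn]; exact hlt2
      have r := ih _ hlt2_n ⟨_, c4⟩ (d - 2 * s) rfl rfl
      refine r.trans ?_
      have s4 : (graph.induce (cylSites t ℓ)).Reachable ⟨_, c4⟩ ⟨_, c3⟩ :=
        (show (graph.induce (cylSites t ℓ)).Adj ⟨_, c4⟩ ⟨_, c3⟩ from a4.symm).reachable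
      have s3 : (graph.induce (cylSites t ℓ)).Reachable ⟨_, c3⟩ ⟨_, c2⟩ :=
        (show (graph.induce (cylSites t ℓ)).Adj ⟨_, c3⟩ ⟨_, c2⟩ from a3.symm).reachable
      have s2 : (graph.induce (cylSites t ℓ)).Reachable ⟨_, c2⟩ ⟨_, c1⟩ :=
        (show (graph.induce (cylSites t ℓ)).Adj ⟨_, c2⟩ ⟨_, c1⟩ from a2.symm).reachable
      have s1 : (graph.induce (cylSites t ℓ)).Reachable ⟨_, c1⟩ ⟨_, hd⟩ :=
        (show (graph.induce (cylSites t ℓ)).Adj ⟨_, c1⟩ ⟨_, hd⟩ from a1.symm).reachable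
      exact s4.trans (s3.trans (s2.trans s1))

/-- **(κ) for nbo, on sites: every cylinder `{w ∈ sites | ‖chart w − chart t‖_∞ ≤ ℓ}`, `ℓ ≥ 1`, at every site `t` induces a CONNECTED
subgraph** (descent by quasi-steps to the fibre, which is chained along the `x`-axis). [cite: KozmaNitzan2024, §4 p. 15 (connected cylinders)] -/
theorem cyl_connected (t : Site 3) (ht : t ∈ sites) (ℓ : ℕ) (hℓ : 1 ≤ ℓ) : (graph.induce (cylSites t ℓ)).Connected := by
  have h1 : t ∈ cylSites t ℓ := ⟨ht, by rw [sub_self]; exact zero_mem_box 2 ℓ⟩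
  haveI : Nonempty (cylSites t ℓ) := ⟨⟨t, h1⟩⟩
  have key : ∀ w : cylSites t ℓ, (graph.induce (cylSites t ℓ)).Reachable ⟨t, h1⟩ w := by
    rintro ⟨w, hw⟩
    obtain ⟨w₀, h₀, hφ, hr⟩ := exists_reachable_fibre t ℓ w hw
    have e : w₀ = t + Pi.single 0 (w₀ 0 - t 0) := eq_add_single_of_chart_eq hφ
    have r0 := fibre_reachable t ht hℓ h1 _ ⟨w₀, h₀⟩ (w₀ 0 - t 0) e rfl
    exact r0.trans hr.symm
  exact ⟨fun u v => (key u).symm.trans (key v)⟩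

end NboZ3

end Summit.CriticalPhenomena.PercolationContinuityZ3.Theorems.Transplant

end
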